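import Mathlib.MeasureTheory.Function.Floor
import Literature.Analysis.FluidPDE.RusinSverakLerayStability
import Literature.Analysis.FluidPDE.SuitableWeakPressure
import HarnessLib

/-!
# Renormalising the pressures of a sequence of local Leray solutions by functions of time

Analysis/FluidPDE support file (theorems only, [folklore]) for the assembly of the weak `L³`
stability of local Leray solutions (`jia_sverak_leray_weak_stability`,
`NSLerayHopfSereginStability.lean`; Jia–Šverák 2013, proof of Thm. 1) from its printed
ingredients (`JiaSverakCompactness.lean`). The a priori estimate for Leray solutions with `L³`
data (Jia–Šverák 2013, Cor. 1; Rusin–Šverák 2011, Lemma 4.1) bounds the pressure only after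
subtraction of "a suitable function `p_{x₀,r}(t)` of `t`" on each cylinder `(0, r²) × B_r(x₀)`,
whereas the compactness theorem (Rusin–Šverák 2011, Prop. 2.2) wants ONE pressure per solution,
bounded in `L^{3/2}` on every compact set uniformly along the sequence ("we can change the
pressure by any function depending on `t` only", ibid. p. 4). This file supplies the bookkeeping:

* `exists_glue_bound` — gluing the renormalisers `c_n` of the cylinders `(0, (n+1)²) × B_{n+1}(0)`
  in time, `c(t) = c_{⌊√t⌋}(t)`, gives `∫∫_{(0,T) × B_R} |p − c(t)|^{3/2} ≤ B(C, T, R)` whenever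
  `∫∫_{(0,(n+1)²) × B_{n+1}} |p − c_n|^{3/2} ≤ C (n+1)²` for all `n` — a bound uniform in `p`
  (pieces `{⌊√t⌋ = n}`, `n ≤ ⌈max R √T⌉`, compared with the top renormaliser on the common
  cylinders; the differences `c_N − c_n` are functions of time, whose cylinder integrals scale
  with the volume of the ball, `lintegral_prod_of_time_only`);
* `IsLocalLeraySolution.sub_pressure` — `(v, π) ∈ 𝒩(v₀)` and `c` measurable with
  `∫∫_{(0,T) × B_R} |π − c|^{3/2} < ∞` give `(v, π − c) ∈ 𝒩(v₀)` (Kang–Miura–Tsai Def. 3.2; the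
  suitable-weak-solution part is the tree's `IsSuitableWeakSolutionOn.sub_pressure`);
* `RusinSverak2011.CompactnessSituation.congr_limit_ae` — the situation of Prop. 2.2 is
  insensitive to a.e. modification of the limit field;
* small tools: compact subsets of the open slab lie in boxes `(0, T) × B_R`
  (`exists_subset_Ioo_prod_ball_of_isCompact`), `L^{3/2}` on sets of finite measure is `L¹`
  (`integrableOn_of_lintegral_rpow_threeHalves_lt_top`), `|a − b|^{3/2} ≤ √2 (|a|^{3/2} + |b|^{3/2})`.

## References

* W. Rusin, V. Šverák, J. Funct. Anal. 260 (2011) = arXiv:0911.0500, §2 p. 4 and Lemma 4.1.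
* H. Jia, V. Šverák, SIAM J. Math. Anal. 45 (2013) = arXiv:1201.1592, Cor. 1 and the Remark
  after (2.6), proof of Thm. 1.
* K. Kang, H. Miura, T.-P. Tsai, IMRN 2021 = arXiv:1812.10509, Def. 3.2, Lemma 3.4.
-/

noncomputable section

open MeasureTheory TopologicalSpace Set Function Filter Metric
open _root_.Topology
open scoped ENNReal NNReal RealInnerProductSpace

namespace Literature.Analysis.FluidPDE


/-! ### Tools: integrals of functions of time over cylinders; compact subsets of the slab -/

/-- **Tonelli for a function of time over a cylinder**: `∫∫_{S × B} g(t) = (∫_S g) · |B|`.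
[folklore] -/
theorem lintegral_prod_of_time_only {g : ℝ → ℝ≥0∞} (hg : Measurable g) (S : Set ℝ)
    (B : Set (EuclideanSpace ℝ (Fin 3))) :
    ∫⁻ z in S ×ˢ B, g z.1 ∂(volume : Measure (ℝ × (EuclideanSpace ℝ (Fin 3)))) = (∫⁻ t in S, g t) * volume B := by
  have hμ : (volume : Measure (ℝ × (EuclideanSpace ℝ (Fin 3)))).restrict (S ×ˢ B) =
      ((volume : Measure ℝ).restrict S).prod ((volume : Measure (EuclideanSpace ℝ (Fin 3))).restrict B) := by
    rw [Measure.volume_eq_prod, Measure.prod_restrict]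
  rw [hμ]
  have h1 : ∫⁻ z, g z.1 ∂((volume : Measure ℝ).restrict S).prod ((volume : Measure (EuclideanSpace ℝ (Fin 3))).restrict B) =
      ∫⁻ z, g z.1 * (fun _ : (EuclideanSpace ℝ (Fin 3)) => (1 : ℝ≥0∞)) z.2
        ∂((volume : Measure ℝ).restrict S).prod ((volume : Measure (EuclideanSpace ℝ (Fin 3))).restrict B) := by
    simp only [mul_one]
  rw [h1, lintegral_prod_mul hg.aemeasurable aemeasurable_const, lintegral_const,
    Measure.restrict_apply_univ, one_mul]

/-- A compact subset of the open slab `(0, ∞) × ℝ³` lies in a box `(0, T) × B_R(0)`. [folklore] -/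
theorem exists_subset_Ioo_prod_ball_of_isCompact {K : Set (ℝ × (EuclideanSpace ℝ (Fin 3)))} (hKc : IsCompact K)
    (hK : K ⊆ ((slab (EuclideanSpace ℝ (Fin 3)) (Ioi 0) isOpen_Ioi : Opens (ℝ × (EuclideanSpace ℝ (Fin 3)))) : Set (ℝ × (EuclideanSpace ℝ (Fin 3))))) :
    ∃ T R : ℝ, 0 < T ∧ 0 < R ∧ K ⊆ Ioo 0 T ×ˢ ball (0 : (EuclideanSpace ℝ (Fin 3))) R := by
  obtain ⟨r, hr⟩ := hKc.isBounded.subset_ball (0 : ℝ × (EuclideanSpace ℝ (Fin 3)))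
  refine ⟨max r 1, max r 1, by positivity, by positivity, fun z hz => ?_⟩
  have h1 := hr hz
  rw [mem_ball, Prod.dist_eq, max_lt_iff] at h1
  obtain ⟨h1, h2⟩ := h1
  rw [Prod.fst_zero, Real.dist_eq, sub_zero] at h1
  rw [Prod.snd_zero, dist_zero_right] at h2
  have ht : 0 < z.1 := by
    have hz' : z ∈ (slab (EuclideanSpace ℝ (Fin 3)) (Ioi 0) isOpen_Ioi : Opens (ℝ × (EuclideanSpace ℝ (Fin 3)))) := hK hz
    exact mem_slab.1 hz'
  refine ⟨⟨ht, ?_⟩, ?_⟩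
  · exact (le_abs_self _).trans_lt (h1.trans_le (le_max_left _ _))
  · rw [mem_ball, dist_zero_right]
    exact h2.trans_le (le_max_left _ _)

/-- `‖a - b‖ₑ^{3/2} ≤ 2^{1/2} (‖a‖ₑ^{3/2} + ‖b‖ₑ^{3/2})`. [folklore] -/
theorem enorm_sub_rpow_threeHalves_le (a b : ℝ) :
    ‖a - b‖ₑ ^ (3 / 2 : ℝ) ≤ (2 : ℝ≥0∞) ^ (1 / 2 : ℝ) * (‖a‖ₑ ^ (3 / 2 : ℝ) + ‖b‖ₑ ^ (3 / 2 : ℝ)) := by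
  have h1 : ‖a - b‖ₑ ^ (3 / 2 : ℝ) ≤ (‖a‖ₑ + ‖b‖ₑ) ^ (3 / 2 : ℝ) := by
    gcongr
    exact enorm_sub_le
  refine h1.trans ?_
  have h2 := ENNReal.rpow_add_le_mul_rpow_add_rpow ‖a‖ₑ ‖b‖ₑ (p := (3 / 2 : ℝ)) (by norm_num)
  norm_num at h2 ⊢
  exact h2

/-! ### Gluing the per-ball renormalisations of the pressure into one function of time -/

/-- The glued renormaliser `t ↦ c_{⌊√t⌋}(t)` is measurable when all `c_n` are. [folklore] -/
theorem measurable_floorSqrt_glue {c : ℕ → ℝ → ℝ} (hc : ∀ n, Measurable (c n)) :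
    Measurable fun t : ℝ => c ⌊Real.sqrt t⌋₊ t := by
  have hF : Measurable fun q : ℝ × ℕ => c q.2 q.1 :=
    measurable_from_prod_countable_left (fun n => hc n)
  exact hF.comp (measurable_id.prodMk (Nat.measurable_floor.comp Real.continuous_sqrt.measurable))

/-- For `t > 0` with `⌊√t⌋ = n` one has `t < (n + 1)²`. [folklore] -/
theorem lt_floor_sqrt_add_one_sq {t : ℝ} (ht : 0 ≤ t) :
    t < ((⌊Real.sqrt t⌋₊ : ℝ) + 1) ^ 2 := by
  have h1 : Real.sqrt t < (⌊Real.sqrt t⌋₊ : ℝ) + 1 := Nat.lt_floor_add_one _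
  calc t = Real.sqrt t ^ 2 := (Real.sq_sqrt ht).symm
    _ < ((⌊Real.sqrt t⌋₊ : ℝ) + 1) ^ 2 := by
        gcongr

/-- `⌊√t⌋ ≤ N` when `0 ≤ t < T` and `√T ≤ N`. [folklore] -/
theorem floor_sqrt_le {t T : ℝ} {N : ℕ} (ht : t < T) (hN : Real.sqrt T ≤ N) :
    ⌊Real.sqrt t⌋₊ ≤ N := by
  refine Nat.floor_le_of_le ?_
  exact (Real.sqrt_le_sqrt ht.le).trans hN

/-- A cylinder `(0, T') × B` lies in the open slab `(0, ∞) × ℝ³` (local copy of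
`IsLocalLeraySolution.Ioo_prod_subset_slab`, `LocalLerayCubicIntegrability.lean`, to keep the
import closure small). [folklore] -/
private theorem Ioo_prod_subset_slab (T' : ℝ) (B : Set (EuclideanSpace ℝ (Fin 3))) :
    Ioo (0 : ℝ) T' ×ˢ B ⊆ ((slab (EuclideanSpace ℝ (Fin 3)) (Ioi 0) isOpen_Ioi : Opens (ℝ × (EuclideanSpace ℝ (Fin 3)))) : Set (ℝ × (EuclideanSpace ℝ (Fin 3)))) := by
  intro z hz
  show z ∈ (slab (EuclideanSpace ℝ (Fin 3)) (Ioi 0) isOpen_Ioi : Opens (ℝ × (EuclideanSpace ℝ (Fin 3))))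
  exact mem_slab.2 (mem_Ioi.2 hz.1.1)

/-- **Gluing of the per-cylinder pressure renormalisations.** Let `C ≥ 0`, `T, R > 0`. There is
a bound `B` such that: whenever `p` is measurable on the slab and `c_n` (`n ∈ ℕ`) are measurable
functions of time with `∫∫_{(0,(n+1)²) × B_{n+1}(0)} |p − c_n(t)|^{3/2} ≤ C (n+1)²` for all `n`,
the glued function `c(t) = c_{⌊√t⌋}(t)` satisfies `∫∫_{(0,T) × B_R(0)} |p − c(t)|^{3/2} ≤ B` —
uniformly in `p` (the pieces `{⌊√t⌋ = n}`, `n ≤ N = ⌈max R √T⌉`, are compared with the `N`-th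
renormalisation on the common cylinders, the differences `c_N − c_n` being functions of time
only, whose cylinder integrals scale with the volume of the ball). [folklore] -/
theorem exists_glue_bound (C : ℝ≥0) {T : ℝ} (R : ℝ) (hT : 0 < T) :
    ∃ B : ℝ≥0, ∀ (p : ℝ → (EuclideanSpace ℝ (Fin 3)) → ℝ) (c : ℕ → ℝ → ℝ),
      AEStronglyMeasurable (uncurry p)
        (volume.restrict ((slab (EuclideanSpace ℝ (Fin 3)) (Ioi 0) isOpen_Ioi : Opens (ℝ × (EuclideanSpace ℝ (Fin 3)))) : Set (ℝ × (EuclideanSpace ℝ (Fin 3))))) →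
      (∀ n, Measurable (c n)) →
      (∀ n : ℕ, ∫⁻ z in Ioo 0 (((n : ℝ) + 1) ^ 2) ×ˢ ball (0 : (EuclideanSpace ℝ (Fin 3))) ((n : ℝ) + 1),
          ‖p z.1 z.2 - c n z.1‖ₑ ^ (3 / 2 : ℝ) ≤ C * ENNReal.ofReal (((n : ℝ) + 1) ^ 2)) →
      ∫⁻ z in Ioo 0 T ×ˢ ball (0 : (EuclideanSpace ℝ (Fin 3))) R, ‖p z.1 z.2 - c ⌊Real.sqrt z.1⌋₊ z.1‖ₑ ^ (3 / 2 : ℝ) ≤ B := by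
  -- the number of pieces
  set N : ℕ := ⌈max R (Real.sqrt T)⌉₊ with hN
  have hRN : R ≤ (N : ℝ) + 1 := by
    have h1 : R ≤ (N : ℝ) := (le_max_left _ _).trans (Nat.le_ceil _)
    linarith
  have hTN : Real.sqrt T ≤ N := (le_max_right _ _).trans (Nat.le_ceil _)
  have hTN2 : T ≤ ((N : ℝ) + 1) ^ 2 := by
    have h1 : T = Real.sqrt T ^ 2 := (Real.sq_sqrt hT.le).symm
    rw [h1]
    have h2 : 0 ≤ Real.sqrt T := Real.sqrt_nonneg T
    nlinarith
  -- the constants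
  set A2 : ℝ≥0∞ := (2 : ℝ≥0∞) ^ (1 / 2 : ℝ) with hA2
  have hA2fin : A2 ≠ ∞ := ENNReal.rpow_ne_top_of_nonneg (by norm_num) ENNReal.ofNat_ne_top
  set D : ℕ → ℝ≥0∞ := fun n => C * ENNReal.ofReal (((n : ℝ) + 1) ^ 2) with hD
  have hDfin : ∀ n, D n ≠ ∞ := fun n => ENNReal.mul_ne_top ENNReal.coe_ne_top ENNReal.ofReal_ne_top
  set V : ℕ → ℝ≥0∞ := fun n => volume (ball (0 : (EuclideanSpace ℝ (Fin 3))) ((n : ℝ) + 1)) with hV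
  have hVpos : ∀ n, V n ≠ 0 := fun n => (measure_ball_pos volume (0 : (EuclideanSpace ℝ (Fin 3))) (by positivity)).ne'
  have hVfin : ∀ n, V n ≠ ∞ := fun n => measure_ball_lt_top.ne
  set VR : ℝ≥0∞ := volume (ball (0 : (EuclideanSpace ℝ (Fin 3))) R) with hVR
  have hVRfin : VR ≠ ∞ := measure_ball_lt_top.ne
  set Bn : ℕ → ℝ≥0∞ := fun n => A2 * (D N + A2 * (D n + D N) * (V n)⁻¹ * VR) with hBn
  have hBnfin : ∀ n, Bn n ≠ ∞ := fun n =>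
    ENNReal.mul_ne_top hA2fin (ENNReal.add_ne_top.2 ⟨hDfin N, ENNReal.mul_ne_top
      (ENNReal.mul_ne_top (ENNReal.mul_ne_top hA2fin (ENNReal.add_ne_top.2 ⟨hDfin n, hDfin N⟩))
        (ENNReal.inv_ne_top.2 (hVpos n))) hVRfin⟩)
  set Btot : ℝ≥0∞ := ∑ n ∈ Finset.range (N + 1), Bn n with hBtot
  have hBfin : Btot ≠ ∞ := ENNReal.sum_ne_top.2 fun n _ => hBnfin n
  refine ⟨Btot.toNNReal, fun p c hp hc hcyl => ?_⟩
  rw [ENNReal.coe_toNNReal hBfin]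
  -- notation for the cylinders and the integrands
  set cyl : ℕ → Set (ℝ × (EuclideanSpace ℝ (Fin 3))) := fun n => Ioo 0 (((n : ℝ) + 1) ^ 2) ×ˢ ball (0 : (EuclideanSpace ℝ (Fin 3))) ((n : ℝ) + 1)
    with hcyl_def
  have hcylsub : ∀ {n m : ℕ}, n ≤ m → cyl n ⊆ cyl m := by
    intro n m hnm
    have h1 : (n : ℝ) + 1 ≤ (m : ℝ) + 1 := by exact_mod_cast Nat.succ_le_succ hnm
    exact prod_mono (Ioo_subset_Ioo le_rfl (by nlinarith)) (ball_subset_ball h1)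
  -- measurability of the integrands on subsets of the slab
  have hmeas : ∀ (n : ℕ) (S : Set (ℝ × (EuclideanSpace ℝ (Fin 3)))),
      S ⊆ ((slab (EuclideanSpace ℝ (Fin 3)) (Ioi 0) isOpen_Ioi : Opens (ℝ × (EuclideanSpace ℝ (Fin 3)))) : Set (ℝ × (EuclideanSpace ℝ (Fin 3)))) →
      AEMeasurable (fun z : ℝ × (EuclideanSpace ℝ (Fin 3)) => ‖p z.1 z.2 - c n z.1‖ₑ ^ (3 / 2 : ℝ)) (volume.restrict S) := by
    intro n S hS
    have h1 : AEStronglyMeasurable (uncurry p) (volume.restrict S) :=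
      hp.mono_measure (Measure.restrict_mono hS le_rfl)
    have h2 : AEMeasurable (fun z : ℝ × (EuclideanSpace ℝ (Fin 3)) => p z.1 z.2 - c n z.1) (volume.restrict S) :=
      h1.aemeasurable.sub ((hc n).comp measurable_fst).aemeasurable
    exact h2.enorm.pow_const _
  -- the pieces `{⌊√t⌋ = n} × B_R`, `n ≤ N`
  set A : ℕ → Set ℝ := fun n => {t | t ∈ Ioo 0 T ∧ ⌊Real.sqrt t⌋₊ = n} with hA_def
  have hAsub : ∀ n, A n ⊆ Ioo 0 (((n : ℝ) + 1) ^ 2) := by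
    rintro n t ⟨ht, hn⟩
    refine ⟨ht.1, ?_⟩
    have := lt_floor_sqrt_add_one_sq ht.1.le
    rwa [hn] at this
  have hAT : ∀ n, A n ⊆ Ioo 0 T := fun n t ht => ht.1
  set piece : Fin (N + 1) → Set (ℝ × (EuclideanSpace ℝ (Fin 3))) := fun i => A i ×ˢ ball (0 : (EuclideanSpace ℝ (Fin 3))) R with hpiece_def
  have hcover : Ioo 0 T ×ˢ ball (0 : (EuclideanSpace ℝ (Fin 3))) R ⊆ ⋃ i, piece i := by
    intro z hz
    have hn : ⌊Real.sqrt z.1⌋₊ ≤ N := floor_sqrt_le hz.1.2 hTN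
    exact mem_iUnion.2 ⟨⟨⌊Real.sqrt z.1⌋₊, Nat.lt_succ_of_le hn⟩, ⟨hz.1, rfl⟩, hz.2⟩
  -- the bound on one piece
  have hpiece : ∀ i : Fin (N + 1),
      ∫⁻ z in piece i, ‖p z.1 z.2 - c ⌊Real.sqrt z.1⌋₊ z.1‖ₑ ^ (3 / 2 : ℝ) ≤ Bn i := by
    intro i
    set n : ℕ := (i : ℕ) with hn_def
    have hnN : n ≤ N := Nat.lt_succ_iff.1 i.2
    have hpsub : piece i ⊆ cyl N := prod_mono ((hAT n).trans (Ioo_subset_Ioo le_rfl hTN2))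
      (ball_subset_ball hRN)
    have hpslab : piece i ⊆ ((slab (EuclideanSpace ℝ (Fin 3)) (Ioi 0) isOpen_Ioi : Opens (ℝ × (EuclideanSpace ℝ (Fin 3)))) : Set (ℝ × (EuclideanSpace ℝ (Fin 3)))) :=
      hpsub.trans (Ioo_prod_subset_slab _ _)
    -- on the piece the integrand is `‖p - c_n‖^{3/2} ≤ A2 (‖p - c_N‖^{3/2} + ‖c_n - c_N‖^{3/2})`
    have hpt : ∀ z ∈ piece i, ‖p z.1 z.2 - c ⌊Real.sqrt z.1⌋₊ z.1‖ₑ ^ (3 / 2 : ℝ) ≤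
        A2 * ‖p z.1 z.2 - c N z.1‖ₑ ^ (3 / 2 : ℝ) + A2 * ‖c n z.1 - c N z.1‖ₑ ^ (3 / 2 : ℝ) := by
      rintro z ⟨⟨-, hz⟩, -⟩
      rw [hz]
      have e : p z.1 z.2 - c n z.1 = (p z.1 z.2 - c N z.1) - (c n z.1 - c N z.1) := by ring
      rw [e, ← mul_add]
      exact enorm_sub_rpow_threeHalves_le _ _
    have hg : Measurable fun t : ℝ => ‖c n t - c N t‖ₑ ^ (3 / 2 : ℝ) :=
      ((hc n).sub (hc N)).enorm.pow_const _
    have hgz : ∀ S : Set (ℝ × (EuclideanSpace ℝ (Fin 3))),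
        AEMeasurable (fun z : ℝ × (EuclideanSpace ℝ (Fin 3)) => ‖c n z.1 - c N z.1‖ₑ ^ (3 / 2 : ℝ)) (volume.restrict S) :=
      fun S => (hg.comp measurable_fst).aemeasurable
    have hgzA : ∀ S : Set (ℝ × (EuclideanSpace ℝ (Fin 3))),
        AEMeasurable (fun z : ℝ × (EuclideanSpace ℝ (Fin 3)) => A2 * ‖c n z.1 - c N z.1‖ₑ ^ (3 / 2 : ℝ)) (volume.restrict S) :=
      fun S => (hgz S).const_mul A2
    have hmeasA : ∀ (m : ℕ) (S : Set (ℝ × (EuclideanSpace ℝ (Fin 3)))),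
        S ⊆ ((slab (EuclideanSpace ℝ (Fin 3)) (Ioi 0) isOpen_Ioi : Opens (ℝ × (EuclideanSpace ℝ (Fin 3)))) : Set (ℝ × (EuclideanSpace ℝ (Fin 3)))) →
        AEMeasurable (fun z : ℝ × (EuclideanSpace ℝ (Fin 3)) => A2 * ‖p z.1 z.2 - c m z.1‖ₑ ^ (3 / 2 : ℝ)) (volume.restrict S) :=
      fun m S hS => (hmeas m S hS).const_mul A2
    -- the two cylinder bounds used below
    have hb1 : ∫⁻ z in piece i, ‖p z.1 z.2 - c N z.1‖ₑ ^ (3 / 2 : ℝ) ≤ D N :=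
      (lintegral_mono_set hpsub).trans (hcyl N)
    have hb2 : ∫⁻ z in piece i, ‖c n z.1 - c N z.1‖ₑ ^ (3 / 2 : ℝ) ≤ A2 * (D n + D N) * (V n)⁻¹ * VR := by
      rw [show (∫⁻ z in piece i, ‖c n z.1 - c N z.1‖ₑ ^ (3 / 2 : ℝ)) =
          (∫⁻ t in A n, ‖c n t - c N t‖ₑ ^ (3 / 2 : ℝ)) * VR from
        lintegral_prod_of_time_only hg (A n) (ball (0 : (EuclideanSpace ℝ (Fin 3))) R)]
      refine mul_le_mul' ?_ le_rfl
      -- `(∫_{A_n} g) |B_{n+1}| = ∫∫_{A_n × B_{n+1}} g ≤ ∫∫_{cyl n} g ≤ A2 (D n + D N)`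
      have hpt' : ∀ z ∈ cyl n, ‖c n z.1 - c N z.1‖ₑ ^ (3 / 2 : ℝ) ≤
          A2 * ‖p z.1 z.2 - c N z.1‖ₑ ^ (3 / 2 : ℝ) + A2 * ‖p z.1 z.2 - c n z.1‖ₑ ^ (3 / 2 : ℝ) := by
        intro z _
        have e : c n z.1 - c N z.1 = (p z.1 z.2 - c N z.1) - (p z.1 z.2 - c n z.1) := by ring
        rw [e, ← mul_add]
        exact enorm_sub_rpow_threeHalves_le _ _
      have hcn : cyl n ⊆ ((slab (EuclideanSpace ℝ (Fin 3)) (Ioi 0) isOpen_Ioi : Opens (ℝ × (EuclideanSpace ℝ (Fin 3)))) : Set (ℝ × (EuclideanSpace ℝ (Fin 3)))) :=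
        Ioo_prod_subset_slab _ _
      have key : (∫⁻ t in A n, ‖c n t - c N t‖ₑ ^ (3 / 2 : ℝ)) * V n ≤ A2 * (D n + D N) := by
        calc (∫⁻ t in A n, ‖c n t - c N t‖ₑ ^ (3 / 2 : ℝ)) * V n
            = ∫⁻ z in A n ×ˢ ball (0 : (EuclideanSpace ℝ (Fin 3))) ((n : ℝ) + 1), ‖c n z.1 - c N z.1‖ₑ ^ (3 / 2 : ℝ) :=
              (lintegral_prod_of_time_only hg (A n) _).symm
          _ ≤ ∫⁻ z in cyl n, ‖c n z.1 - c N z.1‖ₑ ^ (3 / 2 : ℝ) :=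
              lintegral_mono_set (prod_mono (hAsub n) le_rfl)
          _ ≤ ∫⁻ z in cyl n, A2 * ‖p z.1 z.2 - c N z.1‖ₑ ^ (3 / 2 : ℝ) +
                A2 * ‖p z.1 z.2 - c n z.1‖ₑ ^ (3 / 2 : ℝ) :=
              setLIntegral_mono' (measurableSet_Ioo.prod measurableSet_ball) hpt'
          _ = (A2 * ∫⁻ z in cyl n, ‖p z.1 z.2 - c N z.1‖ₑ ^ (3 / 2 : ℝ)) +
                A2 * ∫⁻ z in cyl n, ‖p z.1 z.2 - c n z.1‖ₑ ^ (3 / 2 : ℝ) := by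
              rw [lintegral_add_left' (hmeasA N _ hcn), lintegral_const_mul'' _ (hmeas N _ hcn),
                lintegral_const_mul'' _ (hmeas n _ hcn)]
          _ ≤ A2 * D N + A2 * D n :=
              add_le_add (mul_le_mul' le_rfl ((lintegral_mono_set (hcylsub hnN)).trans (hcyl N)))
                (mul_le_mul' le_rfl (hcyl n))
          _ = A2 * (D n + D N) := by ring
      rw [← div_eq_mul_inv, ENNReal.le_div_iff_mul_le (Or.inl (hVpos n)) (Or.inl (hVfin n))]
      exact key
    have hAmeas : MeasurableSet (A n) :=
      measurableSet_Ioo.inter ((Nat.measurable_floor.comp Real.continuous_sqrt.measurable)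
        (measurableSet_singleton n))
    calc ∫⁻ z in piece i, ‖p z.1 z.2 - c ⌊Real.sqrt z.1⌋₊ z.1‖ₑ ^ (3 / 2 : ℝ)
        ≤ ∫⁻ z in piece i, A2 * ‖p z.1 z.2 - c N z.1‖ₑ ^ (3 / 2 : ℝ) +
            A2 * ‖c n z.1 - c N z.1‖ₑ ^ (3 / 2 : ℝ) :=
          setLIntegral_mono' (hAmeas.prod measurableSet_ball) hpt
      _ = (A2 * ∫⁻ z in piece i, ‖p z.1 z.2 - c N z.1‖ₑ ^ (3 / 2 : ℝ)) +
            A2 * ∫⁻ z in piece i, ‖c n z.1 - c N z.1‖ₑ ^ (3 / 2 : ℝ) := by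
          rw [lintegral_add_right' _ (hgzA _), lintegral_const_mul'' _ (hmeas N _ hpslab),
            lintegral_const_mul'' _ (hgz _)]
      _ ≤ A2 * D N + A2 * (A2 * (D n + D N) * (V n)⁻¹ * VR) :=
          add_le_add (mul_le_mul' le_rfl hb1) (mul_le_mul' le_rfl hb2)
      _ = Bn i := by rw [hBn]; ring
  -- summing the pieces
  calc ∫⁻ z in Ioo 0 T ×ˢ ball (0 : (EuclideanSpace ℝ (Fin 3))) R, ‖p z.1 z.2 - c ⌊Real.sqrt z.1⌋₊ z.1‖ₑ ^ (3 / 2 : ℝ)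
      ≤ ∫⁻ z in ⋃ i, piece i, ‖p z.1 z.2 - c ⌊Real.sqrt z.1⌋₊ z.1‖ₑ ^ (3 / 2 : ℝ) :=
        lintegral_mono_set hcover
    _ ≤ ∑' i, ∫⁻ z in piece i, ‖p z.1 z.2 - c ⌊Real.sqrt z.1⌋₊ z.1‖ₑ ^ (3 / 2 : ℝ) :=
        lintegral_iUnion_le _ _
    _ = ∑ i : Fin (N + 1), ∫⁻ z in piece i, ‖p z.1 z.2 - c ⌊Real.sqrt z.1⌋₊ z.1‖ₑ ^ (3 / 2 : ℝ) :=
        tsum_fintype _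
    _ ≤ ∑ i : Fin (N + 1), Bn i := Finset.sum_le_sum fun i _ => hpiece i
    _ = Btot := by rw [hBtot, Fin.sum_univ_eq_sum_range (fun n => Bn n) (N + 1)]

/-! ### `L^{3/2}` on sets of finite measure; renormalised local Leray solutions -/

/-- On a set of finite measure, a measurable function with `∫ |f|^{3/2} < ∞` is integrable.
[folklore] -/
theorem integrableOn_of_lintegral_rpow_threeHalves_lt_top {S : Set (ℝ × (EuclideanSpace ℝ (Fin 3)))} {f : ℝ × (EuclideanSpace ℝ (Fin 3)) → ℝ}
    (hf : AEStronglyMeasurable f (volume.restrict S)) (hS : volume S ≠ ∞)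
    (hfin : ∫⁻ z in S, ‖f z‖ₑ ^ (3 / 2 : ℝ) < ∞) : IntegrableOn f S volume := by
  haveI : IsFiniteMeasure (volume.restrict S) := ⟨by rwa [Measure.restrict_apply_univ, lt_top_iff_ne_top]⟩
  have hq : (1 : ℝ≥0∞) ≤ 3 / 2 :=
    (ENNReal.le_div_iff_mul_le (Or.inl two_ne_zero) (Or.inl ENNReal.ofNat_ne_top)).2 (by norm_num)
  have hmem : MemLp f (3 / 2 : ℝ≥0∞) (volume.restrict S) := by
    refine ⟨hf, ?_⟩
    rw [eLpNorm_lt_top_iff_lintegral_rpow_enorm_lt_top (by norm_num)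
      (ENNReal.div_ne_top (by norm_num) (by norm_num))]
    have e : ((3 / 2 : ℝ≥0∞)).toReal = (3 / 2 : ℝ) := by
      rw [ENNReal.toReal_div]; norm_num
    rw [e]
    exact hfin
  exact hmem.integrable hq

/-- **Renormalising the pressure of a local Leray solution by a function of time.** If
`(v, π) ∈ 𝒩(v₀)` and `c : ℝ → ℝ` is measurable with `∫∫_{(0,T) × B_R} |π − c(t)|^{3/2} < ∞` for
all `T, R > 0`, then `(v, π − c) ∈ 𝒩(v₀)`: the pressure of a suitable weak solution is determined
only up to functions of time (`IsSuitableWeakSolutionOn.sub_pressure`; Rusin–Šverák 2011, §2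
p. 4: "we can change the pressure by any function depending on `t` only"; Jia–Šverák 2013,
Remark after (2.6)), and the remaining clauses of Kang–Miura–Tsai's Def. 3.2 concern `v` only,
except `π ∈ L^{3/2}_loc(ℝ³ × [0, ∞))`, which is the hypothesis. [folklore] -/
theorem IsLocalLeraySolution.sub_pressure {ν : ℝ} {v₀ : (EuclideanSpace ℝ (Fin 3)) → (EuclideanSpace ℝ (Fin 3))} {v : ℝ → (EuclideanSpace ℝ (Fin 3)) → (EuclideanSpace ℝ (Fin 3))}
    {π : ℝ → (EuclideanSpace ℝ (Fin 3)) → ℝ} (h : IsLocalLeraySolution ν v₀ v π) {c : ℝ → ℝ} (hc : Measurable c)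
    (hfin : ∀ T R : ℝ, 0 < T → 0 < R →
      ∫⁻ z in Ioo 0 T ×ˢ ball (0 : (EuclideanSpace ℝ (Fin 3))) R, ‖π z.1 z.2 - c z.1‖ₑ ^ (3 / 2 : ℝ) < ∞) :
    IsLocalLeraySolution ν v₀ v (fun t x => π t x - c t) := by
  -- `π` is measurable on the slab
  have hπm : AEStronglyMeasurable (uncurry π)
      (volume.restrict ((slab (EuclideanSpace ℝ (Fin 3)) (Ioi 0) isOpen_Ioi : Opens (ℝ × (EuclideanSpace ℝ (Fin 3)))) : Set (ℝ × (EuclideanSpace ℝ (Fin 3))))) :=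
    h.suitable.distributional.2.2.1.aestronglyMeasurable
  -- `∫∫_{(0,T) × B_R} |c|^{3/2} < ∞`
  have hcfin : ∀ T R : ℝ, 0 < T → 0 < R →
      ∫⁻ z in Ioo 0 T ×ˢ ball (0 : (EuclideanSpace ℝ (Fin 3))) R, ‖c z.1‖ₑ ^ (3 / 2 : ℝ) < ∞ := by
    intro T R hT hR
    set S : Set (ℝ × (EuclideanSpace ℝ (Fin 3))) := Ioo 0 T ×ˢ ball (0 : (EuclideanSpace ℝ (Fin 3))) R with hS
    have hSslab : S ⊆ ((slab (EuclideanSpace ℝ (Fin 3)) (Ioi 0) isOpen_Ioi : Opens (ℝ × (EuclideanSpace ℝ (Fin 3)))) : Set (ℝ × (EuclideanSpace ℝ (Fin 3)))) :=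
      Ioo_prod_subset_slab _ _
    have hπS : AEMeasurable (fun z : ℝ × (EuclideanSpace ℝ (Fin 3)) => ‖π z.1 z.2‖ₑ ^ (3 / 2 : ℝ)) (volume.restrict S) :=
      (hπm.mono_measure (Measure.restrict_mono hSslab le_rfl)).aemeasurable.enorm.pow_const _
    have hpt : ∀ z : ℝ × (EuclideanSpace ℝ (Fin 3)), ‖c z.1‖ₑ ^ (3 / 2 : ℝ) ≤
        (2 : ℝ≥0∞) ^ (1 / 2 : ℝ) * ‖π z.1 z.2‖ₑ ^ (3 / 2 : ℝ) +
          (2 : ℝ≥0∞) ^ (1 / 2 : ℝ) * ‖π z.1 z.2 - c z.1‖ₑ ^ (3 / 2 : ℝ) := by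
      intro z
      have e : c z.1 = π z.1 z.2 - (π z.1 z.2 - c z.1) := by ring
      rw [← mul_add]
      calc ‖c z.1‖ₑ ^ (3 / 2 : ℝ) = ‖π z.1 z.2 - (π z.1 z.2 - c z.1)‖ₑ ^ (3 / 2 : ℝ) := by rw [← e]
        _ ≤ _ := enorm_sub_rpow_threeHalves_le _ _
    have h1 : ∫⁻ z in Ioo 0 T ×ˢ closedBall (0 : (EuclideanSpace ℝ (Fin 3))) R, ‖π z.1 z.2‖ₑ ^ (3 / 2 : ℝ) < ∞ :=
      h.pressure T hT _ (isCompact_closedBall _ _)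
    calc ∫⁻ z in S, ‖c z.1‖ₑ ^ (3 / 2 : ℝ)
        ≤ ∫⁻ z in S, (2 : ℝ≥0∞) ^ (1 / 2 : ℝ) * ‖π z.1 z.2‖ₑ ^ (3 / 2 : ℝ) +
            (2 : ℝ≥0∞) ^ (1 / 2 : ℝ) * ‖π z.1 z.2 - c z.1‖ₑ ^ (3 / 2 : ℝ) := lintegral_mono hpt
      _ = (2 : ℝ≥0∞) ^ (1 / 2 : ℝ) * (∫⁻ z in S, ‖π z.1 z.2‖ₑ ^ (3 / 2 : ℝ)) +
            (2 : ℝ≥0∞) ^ (1 / 2 : ℝ) * ∫⁻ z in S, ‖π z.1 z.2 - c z.1‖ₑ ^ (3 / 2 : ℝ) := by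
          rw [lintegral_add_left' (hπS.const_mul _), lintegral_const_mul'' _ hπS,
            lintegral_const_mul' _ _ (ENNReal.rpow_ne_top_of_nonneg (by norm_num) ENNReal.ofNat_ne_top)]
      _ < ∞ := by
          refine ENNReal.add_lt_top.2 ⟨ENNReal.mul_lt_top (ENNReal.rpow_lt_top_of_nonneg (by norm_num)
            ENNReal.ofNat_ne_top) ((lintegral_mono_set (Set.prod_mono le_rfl ball_subset_closedBall)).trans_lt h1),
            ENNReal.mul_lt_top (ENNReal.rpow_lt_top_of_nonneg (by norm_num) ENNReal.ofNat_ne_top)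
              (hfin T R hT hR)⟩
  -- the two hypotheses of `IsSuitableWeakSolutionOn.sub_pressure`
  have hcK : ∀ K ⊆ ((slab (EuclideanSpace ℝ (Fin 3)) (Ioi 0) isOpen_Ioi : Opens (ℝ × (EuclideanSpace ℝ (Fin 3)))) : Set (ℝ × (EuclideanSpace ℝ (Fin 3)))), IsCompact K →
      ∫⁻ z in K, ‖c z.1‖ₑ ^ (3 / 2 : ℝ) < ∞ := by
    intro K hK hKc
    obtain ⟨T, R, hT, hR, hsub⟩ := exists_subset_Ioo_prod_ball_of_isCompact hKc hK
    exact (lintegral_mono_set hsub).trans_lt (hcfin T R hT hR)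
  have hcL : LocallyIntegrableOn (fun z : ℝ × (EuclideanSpace ℝ (Fin 3)) => c z.1)
      ((slab (EuclideanSpace ℝ (Fin 3)) (Ioi 0) isOpen_Ioi : Opens (ℝ × (EuclideanSpace ℝ (Fin 3)))) : Set (ℝ × (EuclideanSpace ℝ (Fin 3)))) volume := by
    rw [locallyIntegrableOn_iff (slab (EuclideanSpace ℝ (Fin 3)) (Ioi 0) isOpen_Ioi).isOpen.isLocallyClosed]
    intro K hK hKc
    obtain ⟨T, R, hT, hR, hsub⟩ := exists_subset_Ioo_prod_ball_of_isCompact hKc hK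
    refine IntegrableOn.mono_set ?_ hsub
    refine integrableOn_of_lintegral_rpow_threeHalves_lt_top
      ((hc.comp measurable_fst).aestronglyMeasurable) ?_ (hcfin T R hT hR)
    exact (measure_mono (Set.prod_mono (Ioo_subset_Icc_self) ball_subset_closedBall) |>.trans_lt
      ((isCompact_Icc.prod (isCompact_closedBall _ _)).measure_lt_top)).ne
  exact
    { suitable := h.suitable.sub_pressure hcL hcK
      sqIntegrable := h.sqIntegrable
      pressure := fun T hT K hK => by
        obtain ⟨r, hr⟩ := hK.isBounded.subset_ball (0 : (EuclideanSpace ℝ (Fin 3)))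
        have hr' : K ⊆ ball (0 : (EuclideanSpace ℝ (Fin 3))) (max r 1) := hr.trans (ball_subset_ball (le_max_left _ _))
        exact (lintegral_mono_set (prod_mono le_rfl hr')).trans_lt (hfin T _ hT (by positivity))
      uniformLocalEnergy := h.uniformLocalEnergy
      uniformLocalGradient := h.uniformLocalGradient
      initial := h.initial
      decay := h.decay }

/-! ### The situation of Prop. 2.2 under a.e. modification of the limit -/

/-- The situation of Rusin–Šverák's Prop. 2.2 is insensitive to a modification of the limit
field on a null set of the open set `O` (all its clauses see the limit through integrals over
subsets of `O`). [folklore] -/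
theorem RusinSverak2011.CompactnessSituation.congr_limit_ae {O : Opens (ℝ × (EuclideanSpace ℝ (Fin 3)))}
    {useq : ℕ → ℝ → (EuclideanSpace ℝ (Fin 3)) → (EuclideanSpace ℝ (Fin 3))} {pseq : ℕ → ℝ → (EuclideanSpace ℝ (Fin 3)) → ℝ} {u u' : ℝ → (EuclideanSpace ℝ (Fin 3)) → (EuclideanSpace ℝ (Fin 3))} {p : ℝ → (EuclideanSpace ℝ (Fin 3)) → ℝ}
    (h : RusinSverak2011.CompactnessSituation O useq pseq u p)
    (hu : ∀ᵐ z ∂(volume.restrict (O : Set (ℝ × (EuclideanSpace ℝ (Fin 3))))), uncurry u z = uncurry u' z) :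
    RusinSverak2011.CompactnessSituation O useq pseq u' p where
  suitable := h.suitable
  energy_bound := h.energy_bound
  gradient_bound := h.gradient_bound
  pressure_bound := h.pressure_bound
  tendsto_lintegral K hK hKc := by
    have e : ∀ k, ∫⁻ z in K, ‖useq k z.1 z.2 - u' z.1 z.2‖ₑ ^ (3 : ℕ) =
        ∫⁻ z in K, ‖useq k z.1 z.2 - u z.1 z.2‖ₑ ^ (3 : ℕ) := by
      intro k
      refine lintegral_congr_ae ?_
      filter_upwards [ae_restrict_of_ae_restrict_of_subset hK hu] with z hz
      simp only [uncurry] at hz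
      rw [hz]
    simp_rw [e]
    exact h.tendsto_lintegral K hK hKc
  tendsto_integral_pressure := h.tendsto_integral_pressure


end Literature.Analysis.FluidPDE

end
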